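import Summits.QuantumFields.YangMills.Theorems.FibreConvexityTailDefs
import Summits.QuantumFields.YangMills.Theorems.PoincareLipschitzTwoSidedOfConcentrationBudget
import Summits.QuantumFields.YangMills.Theses.PoincareLipschitz
import Summits.QuantumFields.YangMills.Theses.RevelationMartingale
import Literature.MathematicalPhysics.QuantumFieldTheory.Balaban1983to89.T4PairDerivBridge
import HarnessLib

/-!
# LINE 27 «MedianCentring» / LINE 28 candidate — support workfile: the SECOND-MOMENT FORM of the centring datum

Def-free, sorry-free bookkeeping for the director's ask (2) (item text for the LINE 28 candidate «gross-sd-transfer») and for the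
(Q) attack map (`MedianCentringQAttackMap.md` §4, px6 g9 LOCATE 058035f29137d86f): a volume- and cut-off-uniform PERTURBATIVE-ORDER
SECOND-MOMENT bound for ONE block-averaged plaquette,

  «BlockSecondMomentL»  ∀ L ∃ C ∃ γ₁ ∀ F (F.L = L) ∀ 0 < γ ≤ γ₁ ∀ 1 ≤ j ≤ K ∀ a,  E_{gibbsK} dist₁(Ū^j(∂a))² ≤ C · γ L^{−(K−j)}  (= C·g_{K−j}²),

closes the whole FIRST-MOMENT ROW of the R3 ladder by Chebyshev / AM–GM alone — `MeanDeviationL` (stmt-23083), the 3/4-quantile (Q)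
(`stub_quantileDeviation` of `Lines/median_centring.lean`, stmt-23133's only active stub) and `MeanDeviationShallowL` (stmt-23133) — with
ROOM `p(g)²/256`: the constant `C` is arbitrary because `θBal² = g²·p(g)²` and `p(g) = b₀(1+log g⁻¹)^{p₀} → ∞` as `γ → 0`
(`sq_log_le_pFun_sq`, `log_inv_coupling_ge`).  So any bound `E d² ≤ C_L g² (1+log g⁻¹)^{q}` with `q < 2p₀`… in particular `q ≤ 4` … would do;
here the plain `q = 0` form is typed.  Nothing is claimed about «BlockSecondMomentL» itself (NOT printed for non-abelian d = 3; it is the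
centring datum in L² form — the reader's «LocalInsertionRatioL» wall, px6 g9); (Q), MeanDeviationL, MeanDeviationShallowL, HistoryTailL and
the rung R3 (YM₃ on T³; NOT d = 4, NOT Clay) remain OPEN.
-/

open MeasureTheory
open Literature.MathematicalPhysics.QuantumFieldTheory.Balaban1983to89
open Literature.MathematicalPhysics.QuantumFieldTheory.Balaban1983to89.T3ContinuumYM3Torus
open Literature.MathematicalPhysics.QuantumFieldTheory.Balaban1983to89.T3UnitScaleTilt
open Literature.MathematicalPhysics.QuantumFieldTheory.Balaban1983to89.T3UnitLawDensityEML (ℰp measurableE_ℰp)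
open Literature.MathematicalPhysics.QuantumFieldTheory.Balaban1983to89.T3MinimiserStabilityReduction (θBal_pos)
open Summit.QuantumFields.YangMills.Theorems.PoincareLipschitz.TwoSidedOfConcentration
  (coupling_basic log_inv_coupling_ge sq_log_le_pFun_sq)

namespace Summit.QuantumFields.YangMills.Cruxes.HistoryTailL.SecondMoment

/-! ## §1 Two probability-space lemmas -/

section Prob

variable {Ω : Type*} [MeasurableSpace Ω] {μ : Measure Ω} [IsProbabilityMeasure μ] {f : Ω → ℝ} {θ : ℝ}

private theorem integrable_sq (hfm : Measurable f) (hf0 : ∀ x, 0 ≤ f x) (hf2 : ∀ x, f x ≤ 2) :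
    Integrable (fun x => f x ^ 2) μ :=
  (integrable_const (4 : ℝ)).mono' (hfm.pow_const 2).aestronglyMeasurable
    (ae_of_all _ fun x => by
      rw [Real.norm_eq_abs, abs_of_nonneg (sq_nonneg _)]
      nlinarith [hf0 x, hf2 x])

private theorem integrable_f (hfm : Measurable f) (hf0 : ∀ x, 0 ≤ f x) (hf2 : ∀ x, f x ≤ 2) :
    Integrable f μ :=
  (integrable_const (2 : ℝ)).mono' hfm.aestronglyMeasurable
    (ae_of_all _ fun x => by rw [Real.norm_eq_abs, abs_of_nonneg (hf0 x)]; exact hf2 x)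

/-- CHEBYSHEV: `∫ f² ≤ θ²/256` puts three quarters of the mass in `{f ≤ θ/8}`. [folklore] -/
theorem threeQuarters_of_sq_integral (hθ : 0 < θ) (hfm : Measurable f) (hf0 : ∀ x, 0 ≤ f x) (hf2 : ∀ x, f x ≤ 2)
    (hV : ∫ x, f x ^ 2 ∂μ ≤ θ ^ 2 / 256) : 3 / 4 ≤ μ.real {x | f x ≤ θ / 8} := by
  have hg_int : Integrable (fun x => f x ^ 2) μ := integrable_sq hfm hf0 hf2
  have hg_nn : 0 ≤ᵐ[μ] (fun x => f x ^ 2) := ae_of_all _ (fun x => sq_nonneg _)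
  have hmarkov : (θ / 8) ^ 2 * μ.real {x | (θ / 8) ^ 2 ≤ f x ^ 2} ≤ ∫ x, f x ^ 2 ∂μ :=
    mul_meas_ge_le_integral_of_nonneg hg_nn hg_int _
  have hsub : {x | f x ≤ θ / 8}ᶜ ⊆ {x | (θ / 8) ^ 2 ≤ f x ^ 2} := by
    intro x hx
    simp only [Set.mem_compl_iff, Set.mem_setOf_eq, not_le] at hx ⊢
    exact pow_le_pow_left₀ (by positivity) hx.le 2
  have h1 : μ.real {x | (θ / 8) ^ 2 ≤ f x ^ 2} ≤ 1 / 4 := by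
    have h := hmarkov.trans hV
    by_contra hcon
    rw [not_le] at hcon
    have hθ2 : 0 < θ ^ 2 := by positivity
    nlinarith [hθ2, hcon, h]
  have h2 : μ.real {x | f x ≤ θ / 8}ᶜ ≤ 1 / 4 := (measureReal_mono hsub).trans h1
  have hS : MeasurableSet {x | f x ≤ θ / 8} := measurableSet_le hfm measurable_const
  have h3 : μ.real {x | f x ≤ θ / 8} + μ.real {x | f x ≤ θ / 8}ᶜ = 1 := by
    rw [measureReal_add_measureReal_compl hS, probReal_univ]
  linarith

/-- AM–GM: `∫ f² ≤ θ²/256` gives `∫ f ≤ θ/16` (pointwise `f ≤ (8/θ)·f² + θ/32`). [folklore] -/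
theorem integral_le_of_sq_integral (hθ : 0 < θ) (hfm : Measurable f) (hf0 : ∀ x, 0 ≤ f x) (hf2 : ∀ x, f x ≤ 2)
    (hV : ∫ x, f x ^ 2 ∂μ ≤ θ ^ 2 / 256) : ∫ x, f x ∂μ ≤ θ / 16 := by
  have hg_int : Integrable (fun x => f x ^ 2) μ := integrable_sq hfm hf0 hf2
  have hf_int : Integrable f μ := integrable_f hfm hf0 hf2
  have hpt : ∀ x, f x ≤ 8 / θ * f x ^ 2 + θ / 32 := by
    intro x
    have h8 : 0 < 8 / θ := by positivity
    have hsq : 0 ≤ 8 / θ * (f x - θ / 16) ^ 2 := by positivity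
    have hexp : 8 / θ * (f x - θ / 16) ^ 2 = 8 / θ * f x ^ 2 - f x + θ / 32 := by
      field_simp
      ring
    linarith [hsq, hexp]
  have hR : Integrable (fun x => 8 / θ * f x ^ 2 + θ / 32) μ := (hg_int.const_mul _).add (integrable_const _)
  calc ∫ x, f x ∂μ ≤ ∫ x, (8 / θ * f x ^ 2 + θ / 32) ∂μ := integral_mono hf_int hR hpt
    _ = 8 / θ * ∫ x, f x ^ 2 ∂μ + θ / 32 := by
        rw [integral_add (hg_int.const_mul _) (integrable_const _), integral_const_mul, integral_const, smul_eq_mul,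
          probReal_univ, one_mul]
    _ ≤ 8 / θ * (θ ^ 2 / 256) + θ / 32 := by
        have h8 : 0 ≤ 8 / θ := by positivity
        nlinarith [mul_le_mul_of_nonneg_left hV h8]
    _ = θ / 16 := by field_simp; ring

end Prob

/-! ## §2 The room: a perturbative-order constant is absorbed by `p(g)²` -/

/-- `C · g_h² ≤ θBal(h)²/256` for all heights `h`, once `γ ≤ exp(−32√C/b₀)` (so that `b₀·log g_h⁻¹ ≥ 16√C`). [folklore] -/
theorem const_mul_coupling_le_θBal_sq {L : ℕ} (hL : 1 ≤ L) {b₀ p₀ C : ℝ} (hb₀ : 0 < b₀) (hp₀ : 1 ≤ p₀) (hC : 0 ≤ C) :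
    ∃ γR : ℝ, 0 < γR ∧ γR ≤ 1 ∧ ∀ γ : ℝ, 0 < γ → γ ≤ γR → ∀ h : ℕ,
      C * (γ * ((L : ℝ)⁻¹) ^ h) ≤ θBal L γ b₀ p₀ h ^ 2 / 256 := by
  set X : ℝ := 16 * Real.sqrt C / b₀ with hX
  refine ⟨min 1 (Real.exp (-(2 * X))), lt_min one_pos (Real.exp_pos _), min_le_left _ _, ?_⟩
  intro γ hγ hγle h
  have hγ1 : γ ≤ 1 := hγle.trans (min_le_left _ _)
  have hγX : γ ≤ Real.exp (-(2 * X)) := hγle.trans (min_le_right _ _)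
  obtain ⟨hg, hg1, hg2, -⟩ := coupling_basic hL hγ hγ1 h
  set g := Real.sqrt (γ * ((L : ℝ)⁻¹) ^ h) with hgdef
  have hlog : X ≤ Real.log g⁻¹ := log_inv_coupling_ge hL hγ hγ1 hγX h
  have hXnn : 0 ≤ X := by rw [hX]; positivity
  have hp2 : b₀ ^ 2 * Real.log g⁻¹ ^ 2 ≤ B10.pFun b₀ p₀ g ^ 2 := sq_log_le_pFun_sq hp₀ hg hg1
  -- `(b₀ X)² = 256 C`
  have hbX : b₀ * X = 16 * Real.sqrt C := by rw [hX]; field_simp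
  have h256 : 256 * C ≤ b₀ ^ 2 * Real.log g⁻¹ ^ 2 := by
    have h1 : b₀ * X ≤ b₀ * Real.log g⁻¹ := mul_le_mul_of_nonneg_left hlog hb₀.le
    have h2 : 0 ≤ b₀ * X := by positivity
    have h3 : (b₀ * X) ^ 2 ≤ (b₀ * Real.log g⁻¹) ^ 2 := pow_le_pow_left₀ h2 h1 2
    have h4 : (b₀ * X) ^ 2 = 256 * C := by
      rw [hbX, mul_pow, Real.sq_sqrt hC]; norm_num
    nlinarith [h3, h4]
  -- assemble: θBal² = g² · p²
  have hθ : θBal L γ b₀ p₀ h ^ 2 = g ^ 2 * B10.pFun b₀ p₀ g ^ 2 := by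
    unfold θBal; rw [← hgdef]; ring
  rw [hθ, hg2]
  have hx : 0 ≤ γ * ((L : ℝ)⁻¹) ^ h := by rw [← hg2]; positivity
  nlinarith [mul_le_mul_of_nonneg_left (h256.trans hp2) hx]

/-! ## §3 The second-moment datum closes the first-moment row -/

/-- **«BlockSecondMomentL» ⇒ the first-moment row at threshold scale.**  For every profile `(b₀,p₀)`: `∫ d² ≤ θ²/256` at all
`1 ≤ j ≤ K`, uniformly in the family. -/
theorem secondMomentTheta_of_secondMoment
    (hV : ∀ (L : ℕ), ∃ C : ℝ, 0 ≤ C ∧ ∃ γ₁ : ℝ, 0 < γ₁ ∧ γ₁ ≤ 1 ∧ ∀ (F : T3Family) (γ : ℝ), F.L = L → 0 < γ → γ ≤ γ₁ →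
          ∀ (K j : ℕ), 1 ≤ j → j ≤ K → ∀ a : Plaq (F.P K) j,
            ∫ U, (GaugeGroup.dist1 (GaugeField.plaqHol (Averaging.iter (fun i' => BlockAveraging.blockAvg (P := F.P K) (j := i') ℰp) j U) a)) ^ 2 ∂(gibbsK F ℰp γ K)
              ≤ C * (γ * ((F.L : ℝ)⁻¹) ^ (K - j)))
    (L : ℕ) {b₀ p₀ : ℝ} (hb₀ : 0 < b₀) (hp₀ : 2 < p₀) :
    ∃ γ₁ : ℝ, 0 < γ₁ ∧ γ₁ ≤ 1 ∧ ∀ (F : T3Family) (γ : ℝ), F.L = L → 0 < γ → γ ≤ γ₁ →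
      ∀ (K j : ℕ), 1 ≤ j → j ≤ K → ∀ a : Plaq (F.P K) j,
        ∫ U, (GaugeGroup.dist1 (GaugeField.plaqHol (Averaging.iter (fun i' => BlockAveraging.blockAvg (P := F.P K) (j := i') ℰp) j U) a)) ^ 2 ∂(gibbsK F ℰp γ K)
          ≤ θBal F.L γ b₀ p₀ (K - j) ^ 2 / 256 := by
  obtain ⟨C, hC, γV, hγV, hγV1, HV⟩ := hV L
  by_cases hL : 1 ≤ L
  swap
  · refine ⟨1, one_pos, le_rfl, fun F γ hFL => ?_⟩
    exact absurd (hFL ▸ F.hL.2) (by omega)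
  obtain ⟨γR, hγR, hγR1, HR⟩ := const_mul_coupling_le_θBal_sq hL hb₀ (by linarith : (1 : ℝ) ≤ p₀) hC
  refine ⟨min γV γR, lt_min hγV hγR, (min_le_left _ _).trans hγV1, ?_⟩
  intro F γ hFL hγ hγle K j hj hjK a
  have h1 := HV F γ hFL hγ (hγle.trans (min_le_left _ _)) K j hj hjK a
  have h2 := HR γ hγ (hγle.trans (min_le_right _ _)) (K - j)
  rw [hFL] at h1 ⊢
  exact h1.trans h2

/-- **«BlockSecondMomentL» ⇒ `MeanDeviationL`** (stmt-QuantumFields-23083, route PoincareLipschitz), by AM–GM. -/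
theorem meanDeviationL_of_secondMoment
    (hV : ∀ (L : ℕ), ∃ C : ℝ, 0 ≤ C ∧ ∃ γ₁ : ℝ, 0 < γ₁ ∧ γ₁ ≤ 1 ∧ ∀ (F : T3Family) (γ : ℝ), F.L = L → 0 < γ → γ ≤ γ₁ →
          ∀ (K j : ℕ), 1 ≤ j → j ≤ K → ∀ a : Plaq (F.P K) j,
            ∫ U, (GaugeGroup.dist1 (GaugeField.plaqHol (Averaging.iter (fun i' => BlockAveraging.blockAvg (P := F.P K) (j := i') ℰp) j U) a)) ^ 2 ∂(gibbsK F ℰp γ K)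
              ≤ C * (γ * ((F.L : ℝ)⁻¹) ^ (K - j))) :
    Summit.QuantumFields.YangMills.Theses.PoincareLipschitz.MeanDeviationL := by
  intro L b₀ p₀ hb₀ hp₀
  obtain ⟨γ₁, hγ₁, hγ₁1, H⟩ := secondMomentTheta_of_secondMoment hV L hb₀ hp₀
  refine ⟨γ₁, hγ₁, hγ₁1, ?_⟩
  intro F γ hFL hγ hγle K j hj hjK a
  have hsq := H F γ hFL hγ hγle K j hj hjK a
  haveI : IsProbabilityMeasure (gibbsK F ℰp γ K) := isProbabilityMeasure_gibbsK F ℰp hγ.le K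
  have hL1 : 1 ≤ F.L := le_of_lt F.hL.2
  have hθpos : 0 < θBal F.L γ b₀ p₀ (K - j) := θBal_pos hL1 hγ (hγle.trans hγ₁1) hb₀ p₀ (K - j)
  have hfm := Summit.QuantumFields.YangMills.Theorems.FibreConvexityTail.measurable_dist1_plaqHol_iter F K j a
  have h := integral_le_of_sq_integral (μ := gibbsK F ℰp γ K) hθpos hfm (fun U => GaugeGroup.dist1_nonneg _)
    (fun U => T4PairDerivBridge.dist1_le_two_specialUnitaryGroup _) hsq
  linarith

/-- **«BlockSecondMomentL» ⇒ (Q)** — the conclusion is the text of `stub_quantileDeviation` of `Cruxes/HistoryTailL/Lines/median_centring.lean`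
VERBATIM (stmt-QuantumFields-23133's only active stub), by Chebyshev. -/
theorem quantileDeviation_of_secondMoment
    (hV : ∀ (L : ℕ), ∃ C : ℝ, 0 ≤ C ∧ ∃ γ₁ : ℝ, 0 < γ₁ ∧ γ₁ ≤ 1 ∧ ∀ (F : T3Family) (γ : ℝ), F.L = L → 0 < γ → γ ≤ γ₁ →
          ∀ (K j : ℕ), 1 ≤ j → j ≤ K → ∀ a : Plaq (F.P K) j,
            ∫ U, (GaugeGroup.dist1 (GaugeField.plaqHol (Averaging.iter (fun i' => BlockAveraging.blockAvg (P := F.P K) (j := i') ℰp) j U) a)) ^ 2 ∂(gibbsK F ℰp γ K)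
              ≤ C * (γ * ((F.L : ℝ)⁻¹) ^ (K - j))) :
    ∀ (L : ℕ) (b₀ p₀ : ℝ), 0 < b₀ → 2 < p₀ → ∃ γ₁ : ℝ, 0 < γ₁ ∧ γ₁ ≤ 1 ∧ ∀ (F : T3Family) (γ : ℝ), F.L = L → 0 < γ → γ ≤ γ₁ →
          ∀ (K j : ℕ), 1 ≤ j → j + 2 ≤ K → ∀ a : Plaq (F.P K) j,
            3 / 4 ≤ (gibbsK F ℰp γ K).real {U : GaugeField (F.P K) 0 (Matrix.specialUnitaryGroup (Fin 2) ℂ) | GaugeGroup.dist1 (GaugeField.plaqHol (Averaging.iter (fun i' => BlockAveraging.blockAvg (P := F.P K) (j := i') ℰp) j U) a) ≤ θBal F.L γ b₀ p₀ (K - j) / 8} := by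
  intro L b₀ p₀ hb₀ hp₀
  obtain ⟨γ₁, hγ₁, hγ₁1, H⟩ := secondMomentTheta_of_secondMoment hV L hb₀ hp₀
  refine ⟨γ₁, hγ₁, hγ₁1, ?_⟩
  intro F γ hFL hγ hγle K j hj hjK a
  have hsq := H F γ hFL hγ hγle K j hj (by omega) a
  haveI : IsProbabilityMeasure (gibbsK F ℰp γ K) := isProbabilityMeasure_gibbsK F ℰp hγ.le K
  have hL1 : 1 ≤ F.L := le_of_lt F.hL.2
  have hθpos : 0 < θBal F.L γ b₀ p₀ (K - j) := θBal_pos hL1 hγ (hγle.trans hγ₁1) hb₀ p₀ (K - j)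
  have hfm := Summit.QuantumFields.YangMills.Theorems.FibreConvexityTail.measurable_dist1_plaqHol_iter F K j a
  exact threeQuarters_of_sq_integral (μ := gibbsK F ℰp γ K) hθpos hfm (fun U => GaugeGroup.dist1_nonneg _)
    (fun U => T4PairDerivBridge.dist1_le_two_specialUnitaryGroup _) hsq

/-- **«BlockSecondMomentL» ⇒ `MeanDeviationShallowL`** (stmt-QuantumFields-23133, LINE 27's registered target) — with `N₁ = 1`, directly
(no K1, no K2: the concentration machinery of LINE 27 is needed only when the datum is the bare 3/4-quantile). -/
theorem meanDeviationShallowL_of_secondMoment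
    (hV : ∀ (L : ℕ), ∃ C : ℝ, 0 ≤ C ∧ ∃ γ₁ : ℝ, 0 < γ₁ ∧ γ₁ ≤ 1 ∧ ∀ (F : T3Family) (γ : ℝ), F.L = L → 0 < γ → γ ≤ γ₁ →
          ∀ (K j : ℕ), 1 ≤ j → j ≤ K → ∀ a : Plaq (F.P K) j,
            ∫ U, (GaugeGroup.dist1 (GaugeField.plaqHol (Averaging.iter (fun i' => BlockAveraging.blockAvg (P := F.P K) (j := i') ℰp) j U) a)) ^ 2 ∂(gibbsK F ℰp γ K)
              ≤ C * (γ * ((F.L : ℝ)⁻¹) ^ (K - j))) :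
    Summit.QuantumFields.YangMills.Theses.RevelationMartingale.MeanDeviationShallowL := by
  intro L
  refine ⟨1, one_pos, fun b₀ p₀ hb₀ hp₀ => ?_⟩
  obtain ⟨γ₁, hγ₁, hγ₁1, H⟩ := meanDeviationL_of_secondMoment hV L b₀ p₀ hb₀ hp₀
  exact ⟨γ₁, hγ₁, hγ₁1, fun F γ hFL hγ hγle K j hj hjK a => H F γ hFL hγ hγle K j hj (by omega) a⟩

end Summit.QuantumFields.YangMills.Cruxes.HistoryTailL.SecondMoment
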